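import Literature.NumberTheory.Li1992.RallisDiagonalSeesaw
import Literature.NumberTheory.Weil1964.AdelicDoublingDefectCharacterTrivial
import HarnessLib

/-!
# Crux H413, E-2 Siegel–Weil sub-line `F0_E2SiegelWeilWeilRange`: the stubs SW0 (twist-free diagonal see-saw) and SW1 (see-saw with the
# arguments absorbed) CLOSED — by-name closers for `Cruxes/H413/Lines/F0_E2SiegelWeilWeilRange.lean` (A-p17 (g13) ED. 3, bf51b9e6845b96eb)

HC_CM is proved only modulo the printed citations until rung 0 closes.  Cell `hodgecm-mathlib`, programme P4, engine E-2, child line typed by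
A-p17 (g13); item stmt-HodgeConjecture-24833.  This file states the two stub TYPES `StubSW0`, `StubSW1` of the line file VERBATIM (with the line's
in-file definitions `vDiagLift`, `boxConj`, `doubledThetaIntegral` unfolded to their bodies — a Theorems file cannot import a Lines file) and proves
them from the Literature cores ★ `Weil1964/AdelicDoublingDefectCharacter(Trivial)` and ★ `Li1992/RallisDiagonalSeesaw` (F0P4-p07 (g2)):

* `sw0_diagChar : ‹StubSW0›` — «the plain doubling lift on the `V`-diagonal IS `ω(s(g,1)) ⊠ conj ω(s(g,1))` on pure tensors»: the defect
  character of ★ `omega_doublingLiftMp_sumTensor_conj` is `1` at `s_pair(g,1)` because `ω(s_pair(g,1))` is `L²`-isometric (`hiso`) —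
  ★ `doublingDefectChar_eq_one_of_lintegral_eq` ([Kudla1994, Thm. 3.1]: `χ_{W⊕W⁻}|_Δ = 1`; the closed form `χ = l2Scaling⁻¹` over the perfect
  group `Sp(𝕎_𝔸)`); the bridge `doublingLiftMp (s_pair(g,1)) = doublingLift (ι(g ⊗ 1))` is ★ `doublingLiftMp_pairSplitting_inl`.
* `sw1_seesawKernel : ‹StubSW1›` — «`K(Φ₁,Φ₂)(x₁Γ, x₂Γ) = I□((ω(x₁⁻¹)Φ₁) ⊠ conj(ω(x₂⁻¹)Φ₂))` given the SW0-body»: absorption ★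
  `innerKernel_mk_mk_eq_one_one`, the kernel at `(ξ̃Γ, 1Γ)` ★ `thetaKer_mk_one`, `Θ(A ⊠ B̄) = Θ(A) conj Θ(B)`, and the SW0-body pointwise at
  `g = ξ̃⁻¹` ([Li1992, (24) p. 184]; [Kudla1984, §1]).

The folds in the line file are `theorem stub_SW0_diagChar : StubSW0 := E2SWDiagonalSeesaw.sw0_diagChar` and
`theorem stub_SW1_seesawKernel : StubSW1 := E2SWDiagonalSeesaw.sw1_seesawKernel` (definitional unfolding of the three in-file `def`s).

## References
[Li1992] (13) p. 181–182, (24) p. 184 · [Kudla1994] Thm. 3.1 · [HarrisKudlaSweet1996] §1 (1.4)–(1.5) · [Kudla1984] §1 · [Weil1964] Chap. III n° 37–41.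
-/

set_option autoImplicit false

noncomputable section

-- Mathlib's measure ∕ quotient APIs are stated across semireducible wrappers (as in the line file).
set_option backward.isDefEq.respectTransparency false
set_option linter.dupNamespace false

namespace Summit.HodgeConjecture.HodgeConjecture.Cruxes.H413.E2SWDiagonalSeesaw

open scoped Matrix ComplexConjugate ENNReal
open _root_.MeasureTheory NumberField
open Literature.RepresentationTheory.HeisenbergGroup
open Literature.NumberTheory.Weil1964 Literature.NumberTheory.Automorphic
open Literature.NumberTheory.GelbartRogawski1991 Literature.NumberTheory.GelbartRogawski1991.UnitaryDualPair
open Literature.NumberTheory.Li1992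

/-- **SW0 — THE DIAGONAL SEE-SAW IS TWIST-FREE** (the line's `StubSW0`, verbatim with `vDiagLift`∕`boxConj` unfolded): for the rank-one unitary
dual pair with a compatible splitting `s` whose pair representation is `L²(ν_X)`-isometric (`hiso`), the plain doubling lift on the `V`-diagonal acts on
pure tensors as `ω(s(g,1)) ⊠ conj ω(s(g,1))`: `ω□(S̃(ι(g ⊗ 1)))(Φ₁ ⊠ Φ̄₂) = (ω(g,1)Φ₁) ⊠ conj(ω(g,1)Φ₂)`.
[cite: Kudla1994, Thm. 3.1 p. 378] [cite: HarrisKudlaSweet1996, §1 (1.4)–(1.5)] [cite: Li1992, p. 181] -/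
theorem sw0_diagChar :
  ∀ (F E : Type) [Field F] [NumberField F] [Field E] [NumberField E] [Algebra F E]
    (c : E ≃ₐ[F] E) (N : ℕ) {n : ℕ} (e : Fin N × Fin 1 ≃ Fin n)
    {TV : Matrix (Fin N) (Fin N) F} {TW : Matrix (Fin 1) (Fin 1) F}
    [Algebra.IsQuadraticExtension F E] {δ : E} (hcδ : c δ = -δ) (hδ : δ ≠ 0) {d : F}
    (hd : δ * δ = algebraMap F E d) (hV : TV.IsSymm) (hW : TW.IsSymm) (hVd : IsUnit TV.det) (hWd : IsUnit TW.det)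
    [LocallyCompactSpace (UnitaryGroup.adelic F E c N (TV.map (algebraMap F E)))]
    [LocallyCompactSpace (UnitaryGroup.adelic F E c 1 (TW.map (algebraMap F E)))]
    (s : UnitaryGroup.adelicPair F E c N 1 (TV.map (algebraMap F E)) (TW.map (algebraMap F E)) →*
      adelicMpCont F (Fin n) (adelicGram F e TV TW))
    (hs : (splittingDatum F E c N 1 e (TV.map (algebraMap F E)) (TW.map (algebraMap F E)) hcδ hδ hd hV hW hVd hWd rfl rfl).IsCompatible s)
    [MeasurableSpace (AdeleRing (𝓞 F) F)] [BorelSpace (AdeleRing (𝓞 F) F)]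
    (νX : Measure (Fin n → AdeleRing (𝓞 F) F)) [νX.IsAddHaarMeasure]
    (hiso : ∀ (p : UnitaryGroup.adelic F E c N (TV.map (algebraMap F E)) × UnitaryGroup.adelic F E c 1 (TW.map (algebraMap F E)))
        (Φ : piSchwartzBruhat F (Fin n)),
      ∫⁻ x, ‖((pairRep F E c N 1 e (TV.map (algebraMap F E)) (TW.map (algebraMap F E)) s) p Φ :
          (Fin n → AdeleRing (𝓞 F) F) → ℂ) x‖ₑ ^ 2 ∂νX =
        ∫⁻ x, ‖(Φ : (Fin n → AdeleRing (𝓞 F) F) → ℂ) x‖ₑ ^ 2 ∂νX),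
    ∀ (g : UnitaryGroup.adelic F E c N (TV.map (algebraMap F E))) (Φ₁ Φ₂ : piSchwartzBruhat F (Fin n)),
      adelicMpCont.omega F (Fin (n + n)) (doubledGramFin F (adelicGram F e TV TW))
          (((doublingLift F (adelicGram F e TV TW) (isUnit_det_adelicGram F e hVd hWd)).comp
          ((toSp F E c N 1 e (TV.map (algebraMap F E)) (TW.map (algebraMap F E)) hcδ hδ hd hV hW rfl rfl).comp
            (UnitaryGroup.adelicInl F E c N 1 (TV.map (algebraMap F E)) (TW.map (algebraMap F E))))) g) (piSBReindex F finSumFinEquiv (tensorToSum F (Fin n) (Fin n) Φ₁ (piSchwartzBruhatConj F (Fin n) Φ₂))) =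
        piSBReindex F finSumFinEquiv (tensorToSum F (Fin n) (Fin n) ((pairRep F E c N 1 e (TV.map (algebraMap F E)) (TW.map (algebraMap F E)) s) (g, 1) Φ₁) (piSchwartzBruhatConj F (Fin n) ((pairRep F E c N 1 e (TV.map (algebraMap F E)) (TW.map (algebraMap F E)) s) (g, 1) Φ₂)))
 := by
  intro F E _ _ _ _ _ c N n e TV TW _ δ hcδ hδ d hd hV hW hVd hWd _ _ s hs _ _ νX _ hiso g Φ₁ Φ₂
  -- the defect character is `1` at `s_pair(g,1)` (unitarity `hiso`)
  have hχ : doublingDefectChar F (adelicGram F e TV TW) (isUnit_det_adelicGram F e hVd hWd)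
      (pairSplitting F E c N 1 e (TV.map (algebraMap F E)) (TW.map (algebraMap F E)) s (g, 1)) = 1 :=
    doublingDefectChar_eq_one_of_lintegral_eq F (adelicGram F e TV TW) (isUnit_det_adelicGram F e hVd hWd) νX
      fun Φ => hiso (g, 1) Φ
  -- the see-saw up to the character, at `x := s_pair(g,1)`
  have h := omega_doublingLiftMp_sumTensor_conj F (adelicGram F e TV TW) (isUnit_det_adelicGram F e hVd hWd)
    (pairSplitting F E c N 1 e (TV.map (algebraMap F E)) (TW.map (algebraMap F E)) s (g, 1)) Φ₁ Φ₂
  -- `doublingLiftMp (s_pair(g,1)) = doublingLift (ι(g ⊗ 1))`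
  have hb := doublingLiftMp_pairSplitting_inl F E c N 1 e (TV.map (algebraMap F E)) (TW.map (algebraMap F E)) hcδ hδ hd hV hW hVd hWd
    rfl rfl hs g
  exact (congrArg (fun y : adelicMpCont F (Fin (n + n)) (doubledGramFin F (adelicGram F e TV TW)) =>
      adelicMpCont.omega F (Fin (n + n)) (doubledGramFin F (adelicGram F e TV TW)) y
        (sumTensor F finSumFinEquiv.symm Φ₁ (piSchwartzBruhatConj F (Fin n) Φ₂))) hb).symm.trans
    (h.trans ((congrArg (fun u : ℂˣ => (u : ℂ) •
      sumTensor F finSumFinEquiv.symm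
        (adelicMpCont.omega F (Fin n) (adelicGram F e TV TW)
          (pairSplitting F E c N 1 e (TV.map (algebraMap F E)) (TW.map (algebraMap F E)) s (g, 1)) Φ₁)
        (piSchwartzBruhatConj F (Fin n) (adelicMpCont.omega F (Fin n) (adelicGram F e TV TW)
          (pairSplitting F E c N 1 e (TV.map (algebraMap F E)) (TW.map (algebraMap F E)) s (g, 1)) Φ₂))) hχ).trans
      (one_smul ℂ _)))

/-- **SW1 — THE SEE-SAW WITH THE `x`'S ABSORBED, GIVEN SW0** (the line's `StubSW1`, verbatim with `vDiagLift`∕`boxConj`∕`doubledThetaIntegral` unfolded):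
`K(Φ₁,Φ₂)(x₁Γ, x₂Γ) = ∫_{[U(J_V)]} Θ(ω□(S̃(ι(ξ̃⁻¹ ⊗ 1)))((ω(1,x₁⁻¹)Φ₁) ⊠ conj(ω(1,x₂⁻¹)Φ₂))) dν(ξ)` — absorption (★ `innerKernel_mk_mk_eq_one_one`),
`θ_Φ(ξ̃Γ, 1Γ) = Θ(ω(s(ξ̃⁻¹,1))Φ)` (★ `thetaKer_mk_one`), `Θ(A ⊠ B̄) = Θ(A) conj Θ(B)`, and the SW0-body at `g = ξ̃⁻¹`.
[cite: Kudla1984, §1] [cite: Li1992, (13) p. 181–182 and (24) p. 184] -/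
theorem sw1_seesawKernel :
  ∀ (F E : Type) [Field F] [NumberField F] [Field E] [NumberField E] [Algebra F E]
    (c : E ≃ₐ[F] E) (N : ℕ) {n : ℕ} (e : Fin N × Fin 1 ≃ Fin n)
    {TV : Matrix (Fin N) (Fin N) F} {TW : Matrix (Fin 1) (Fin 1) F}
    [Algebra.IsQuadraticExtension F E] {δ : E} (hcδ : c δ = -δ) (hδ : δ ≠ 0) {d : F}
    (hd : δ * δ = algebraMap F E d) (hV : TV.IsSymm) (hW : TW.IsSymm) (hVd : IsUnit TV.det) (hWd : IsUnit TW.det)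
    [LocallyCompactSpace (UnitaryGroup.adelic F E c N (TV.map (algebraMap F E)))]
    [LocallyCompactSpace (UnitaryGroup.adelic F E c 1 (TW.map (algebraMap F E)))]
    (s : UnitaryGroup.adelicPair F E c N 1 (TV.map (algebraMap F E)) (TW.map (algebraMap F E)) →*
      adelicMpCont F (Fin n) (adelicGram F e TV TW))
    (hs : (splittingDatum F E c N 1 e (TV.map (algebraMap F E)) (TW.map (algebraMap F E)) hcδ hδ hd hV hW hVd hWd rfl rfl).IsCompatible s)
    (hρ : HasThetaMajorants fun (p : UnitaryGroup.adelic F E c N (TV.map (algebraMap F E)) ×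
        UnitaryGroup.adelic F E c 1 (TW.map (algebraMap F E))) (Φ : piSchwartzBruhat F (Fin n)) =>
      pairRep F E c N 1 e (TV.map (algebraMap F E)) (TW.map (algebraMap F E)) s p Φ)
    (SK : Set (piSchwartzBruhat F (Fin n)))
    (hSK : ∀ (h : UnitaryGroup.adelic F E c 1 (TW.map (algebraMap F E))) (Φ : piSchwartzBruhat F (Fin n)), Φ ∈ SK →
      pairRep F E c N 1 e (TV.map (algebraMap F E)) (TW.map (algebraMap F E)) s (1, h) Φ ∈ SK)
    [CompactSpace (UnitaryGroup.adelic F E c N (TV.map (algebraMap F E)) ⧸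
      (UnitaryGroup.toAdelic F E c N (TV.map (algebraMap F E))).range)]
    [CompactSpace (UnitaryGroup.adelic F E c 1 (TW.map (algebraMap F E)) ⧸
      (UnitaryGroup.toAdelic F E c 1 (TW.map (algebraMap F E))).range)]
    [MeasurableSpace (UnitaryGroup.adelic F E c N (TV.map (algebraMap F E)) ⧸
      (UnitaryGroup.toAdelic F E c N (TV.map (algebraMap F E))).range)]
    [BorelSpace (UnitaryGroup.adelic F E c N (TV.map (algebraMap F E)) ⧸
      (UnitaryGroup.toAdelic F E c N (TV.map (algebraMap F E))).range)]
    (ν : Measure (UnitaryGroup.adelic F E c N (TV.map (algebraMap F E)) ⧸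
      (UnitaryGroup.toAdelic F E c N (TV.map (algebraMap F E))).range))
    [IsFiniteMeasure ν] [ν.IsOpenPosMeasure]
    [SMulInvariantMeasure (UnitaryGroup.adelic F E c N (TV.map (algebraMap F E)))
      (UnitaryGroup.adelic F E c N (TV.map (algebraMap F E)) ⧸ (UnitaryGroup.toAdelic F E c N (TV.map (algebraMap F E))).range) ν],
    (∀ (g : UnitaryGroup.adelic F E c N (TV.map (algebraMap F E))) (Φ₁ Φ₂ : piSchwartzBruhat F (Fin n)),
      adelicMpCont.omega F (Fin (n + n)) (doubledGramFin F (adelicGram F e TV TW))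
          (((doublingLift F (adelicGram F e TV TW) (isUnit_det_adelicGram F e hVd hWd)).comp
          ((toSp F E c N 1 e (TV.map (algebraMap F E)) (TW.map (algebraMap F E)) hcδ hδ hd hV hW rfl rfl).comp
            (UnitaryGroup.adelicInl F E c N 1 (TV.map (algebraMap F E)) (TW.map (algebraMap F E))))) g) (piSBReindex F finSumFinEquiv (tensorToSum F (Fin n) (Fin n) Φ₁ (piSchwartzBruhatConj F (Fin n) Φ₂))) =
        piSBReindex F finSumFinEquiv (tensorToSum F (Fin n) (Fin n) ((pairRep F E c N 1 e (TV.map (algebraMap F E)) (TW.map (algebraMap F E)) s) (g, 1) Φ₁) (piSchwartzBruhatConj F (Fin n) ((pairRep F E c N 1 e (TV.map (algebraMap F E)) (TW.map (algebraMap F E)) s) (g, 1) Φ₂)))) →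
    ∀ (Φ₁ Φ₂ : piSchwartzBruhat F (Fin n)) (x₁ x₂ : UnitaryGroup.adelic F E c 1 (TW.map (algebraMap F E))),
      (thetaKernelDatum F E c N 1 e (TV.map (algebraMap F E)) (TW.map (algebraMap F E)) hcδ hδ hd hV hW hVd hWd rfl rfl s hs hρ SK hSK).innerKernel ν Φ₁ Φ₂ (x₁ : UnitaryGroup.adelic F E c 1 (TW.map (algebraMap F E)) ⧸ _)
          (x₂ : UnitaryGroup.adelic F E c 1 (TW.map (algebraMap F E)) ⧸ _) =
        ∫ ξ, thetaDistLM F (Fin (n + n))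
          (adelicMpCont.omega F (Fin (n + n)) (doubledGramFin F (adelicGram F e TV TW))
            (((doublingLift F (adelicGram F e TV TW) (isUnit_det_adelicGram F e hVd hWd)).comp
          ((toSp F E c N 1 e (TV.map (algebraMap F E)) (TW.map (algebraMap F E)) hcδ hδ hd hV hW rfl rfl).comp
            (UnitaryGroup.adelicInl F E c N 1 (TV.map (algebraMap F E)) (TW.map (algebraMap F E))))) (Quotient.out ξ)⁻¹)
            (piSBReindex F finSumFinEquiv (tensorToSum F (Fin n) (Fin n) ((pairRep F E c N 1 e (TV.map (algebraMap F E)) (TW.map (algebraMap F E)) s) (1, x₁⁻¹) Φ₁) (piSchwartzBruhatConj F (Fin n) ((pairRep F E c N 1 e (TV.map (algebraMap F E)) (TW.map (algebraMap F E)) s) (1, x₂⁻¹) Φ₂))))) ∂ν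
 := by
  intro F E _ _ _ _ _ c N n e TV TW _ δ hcδ hδ d hd hV hW hVd hWd _ _ s hs hρ SK hSK _ _ _ _ ν _ _ _ H0 Φ₁ Φ₂ x₁ x₂
  refine (innerKernel_mk_mk_eq_one_one
    (thetaKernelDatum F E c N 1 e (TV.map (algebraMap F E)) (TW.map (algebraMap F E)) hcδ hδ hd hV hW hVd hWd rfl rfl s hs hρ SK hSK)
    ν Φ₁ Φ₂ x₁ x₂).trans ?_
  refine (innerKernel_apply
    (thetaKernelDatum F E c N 1 e (TV.map (algebraMap F E)) (TW.map (algebraMap F E)) hcδ hδ hd hV hW hVd hWd rfl rfl s hs hρ SK hSK)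
    ν _ _ _ _).trans
    (congrArg (fun f : (UnitaryGroup.adelic F E c N (TV.map (algebraMap F E)) ⧸
        (UnitaryGroup.toAdelic F E c N (TV.map (algebraMap F E))).range) → ℂ => ∫ ξ, f ξ ∂ν) (funext fun ξ => ?_))
  -- pointwise at `ξ = ξ̃Γ`, `ξ̃ = ξ.out`
  have hξ : ((ξ.out : UnitaryGroup.adelic F E c N (TV.map (algebraMap F E))) :
      UnitaryGroup.adelic F E c N (TV.map (algebraMap F E)) ⧸ (UnitaryGroup.toAdelic F E c N (TV.map (algebraMap F E))).range) = ξ :=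
    QuotientGroup.out_eq' ξ
  refine (congrArg (fun q : UnitaryGroup.adelic F E c N (TV.map (algebraMap F E)) ⧸
      (UnitaryGroup.toAdelic F E c N (TV.map (algebraMap F E))).range =>
      (thetaKernelDatum F E c N 1 e (TV.map (algebraMap F E)) (TW.map (algebraMap F E)) hcδ hδ hd hV hW hVd hWd rfl rfl s hs hρ SK hSK).thetaKer
          ((thetaKernelDatum F E c N 1 e (TV.map (algebraMap F E)) (TW.map (algebraMap F E)) hcδ hδ hd hV hW hVd hWd rfl rfl s hs hρ SK hSK).W.act
            ((thetaKernelDatum F E c N 1 e (TV.map (algebraMap F E)) (TW.map (algebraMap F E)) hcδ hδ hd hV hW hVd hWd rfl rfl s hs hρ SK hSK).s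
              (1, x₁⁻¹)) Φ₁)
          (q, ((1 : UnitaryGroup.adelic F E c 1 (TW.map (algebraMap F E))) :
            UnitaryGroup.adelic F E c 1 (TW.map (algebraMap F E)) ⧸ (UnitaryGroup.toAdelic F E c 1 (TW.map (algebraMap F E))).range)) *
        conj ((thetaKernelDatum F E c N 1 e (TV.map (algebraMap F E)) (TW.map (algebraMap F E)) hcδ hδ hd hV hW hVd hWd rfl rfl s hs hρ SK hSK).thetaKer
          ((thetaKernelDatum F E c N 1 e (TV.map (algebraMap F E)) (TW.map (algebraMap F E)) hcδ hδ hd hV hW hVd hWd rfl rfl s hs hρ SK hSK).W.act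
            ((thetaKernelDatum F E c N 1 e (TV.map (algebraMap F E)) (TW.map (algebraMap F E)) hcδ hδ hd hV hW hVd hWd rfl rfl s hs hρ SK hSK).s
              (1, x₂⁻¹)) Φ₂)
          (q, ((1 : UnitaryGroup.adelic F E c 1 (TW.map (algebraMap F E))) :
            UnitaryGroup.adelic F E c 1 (TW.map (algebraMap F E)) ⧸ (UnitaryGroup.toAdelic F E c 1 (TW.map (algebraMap F E))).range))))
    hξ.symm).trans ?_
  -- the two kernels at `(ξ̃Γ, 1Γ)`
  refine (congrArg₂ (fun a b : ℂ => a * conj b)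
    (thetaKer_mk_one F E c N 1 e (TV.map (algebraMap F E)) (TW.map (algebraMap F E)) hcδ hδ hd hV hW hVd hWd rfl rfl hs hρ SK hSK _ ξ.out)
    (thetaKer_mk_one F E c N 1 e (TV.map (algebraMap F E)) (TW.map (algebraMap F E)) hcδ hδ hd hV hW hVd hWd rfl rfl hs hρ SK hSK _ ξ.out)).trans
    ?_
  -- `Θ(A') conj Θ(B') = Θ_{n+n}(A' ⊠ B̄')` and the SW0-body at `g = ξ̃⁻¹`
  refine ((congrArg (thetaDistLM F (Fin n) _ * ·) (thetaDistLM_piSchwartzBruhatConj _).symm).trans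
    (thetaDistLM_sumTensor_finSumFinEquiv_symm F _ _).symm).trans ?_
  exact (congrArg (thetaDistLM F (Fin (n + n))) (H0 (ξ.out)⁻¹ _ _)).symm

end Summit.HodgeConjecture.HodgeConjecture.Cruxes.H413.E2SWDiagonalSeesaw

end
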